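import Summits.QuantumFields.YangMills.Theorems.AlphaInputsT3ACv3StepLowCharge
import Summits.QuantumFields.YangMills.Theorems.AlphaInputsT3ACWindowInChiMinOfRows
import HarnessLib

/-!
# `AlphaInputsT3ACv3StepLowMaxB3` — THE LOWER ROW (R3D-02χ) AT THE T³ RECORD ON THE CONSTANT-`max B₃ 1` FAMILY, FROM THE ROWS RECORD: the (E1) edition
# assembled (cell `ym3-torus`, ★★OWNER g35's (α)-row LOCATE sweep 2026-08-30, row #23 `fibre57LowOn`; seat `ym3-torus-px20` g13, width copy of p1;
# `--supports stmt-QuantumFields-19936 --as helper`)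

WHAT.  One composition, no new estimate: ✓`PinnedStepTrivPins.fibre57LowOnAC_T3_of_le_gamma_of_hcharge` (the T³ lower row with `hpos ↦ (hlom₁, hcharge)`,
✓`AlphaInputsT3ACv3StepLowCharge`) READ AT the family `lo j := {(4)-window j} ∩ chiMinAC 𝔠.lane q.X (max 𝔠.B₃ 1) j` of a version-agnostic rows record
`q : AlphaInputsT3AC.PkgCoreRows F 𝔠 γ hγ hγ1 K`, with EVERY letter the record supplies DISCHARGED BY NAME: the averaging letter `hav`
(✓`PinnedStepTrivPins.avg_XT3_eq_avgFun`), the data rows `hU`∕`hPm`∕`hPb` (the step rows `(q.runRows.steps k hk).hU∕hPm∕hPb` at `Hist.triv`, `cP := q.𝔄.cP k`), and the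
three level-`k` family letters `hlom`∕`hloinv`∕`hdom` plus `hlom₁` (✓`AlphaInputsT3AC.PkgCoreRows.hlom_of_rows`∕`hloinv_of_rows`∕`hdom_of_rows`, row r1 at the full radius,
✓`AlphaInputsT3ACWindowInChiMinOfRows`).  ★★★ `AlphaInputsT3AC.PkgCoreRows.fibre57LowOnAC_T3_maxB₃_of_hcharge`: under the data-smallness threshold `θBal ≤ a₁` and the size
window on `γ`, the lower row on that family holds MODULO EXACTLY: the chart binders `(Φ, J, T, hΦ, hJ, hT, hmap, hfib)` (✓`exists_weightedFibreChart_global_T3` supplies them),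
the Gaussian datum `(N, lσ, dg, q_1, hqm, hZ)`, the gauge invariance `hinv` (B0), the (55)∕(58) PINS `hσ hdg hstar hZU hFl` of `q.𝔖` at the trivial history (B0 DEFINER), and
the charging letter `hcharge` (19936 evidence «LOCATE-ALPHA-23-hcharge-supplier»: χ^min point ∕ sharp symmetric Prop. 2 ∕ local submersion of (0.4) — with the (E1) floor
`2·max(B₃,1) < L^{3∕2}` when supplied on this family).  This is the (E1) edition of [Balaban1985UV3]'s lower bound step at the T³ record as ONE theorem with the minimal
displayed list; the family is NOT print's `loPrintAC` (`c = 1`), by design (19936 evidence #57).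

HONEST SCOPE.  [folklore] composition; def-free; nothing of [Balaban1985UV3] (37)∕(47)∕(57), of row #23 on `loPrintAC`, of the (α) data rows (0∕23), of (O‴χₛ), `HistoryTailL`
(19936), EX, LOWB∘ or `YM3TorusSU2` is proved (rung R3 = SU(2) YM₃ on T³, a RECORD rung: NOT d = 4, NOT infinite volume, NOT a mass gap, NOT Clay; the Yang–Mills mass gap is
NOT proved).  L-floor: none here (the floor lives in `hcharge`'s supplier).
References: T. Bałaban, Commun. Math. Phys. **102** (1985) 255–275 [Balaban1985UV3] ((37) p.265, (47) p.267, (49)–(58) pp.268–270, p.272 L32–33); Commun. Math. Phys. **102** (1985)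
277–309 [Balaban1985Variational] (Thm 1 (8) p.279).
-/

set_option autoImplicit false

noncomputable section

namespace Summit.QuantumFields.YangMills.Theorems

open MeasureTheory Literature.MathematicalPhysics.QuantumFieldTheory.Balaban1983to89
open Literature.MathematicalPhysics.QuantumFieldTheory.Balaban1983to89.GaugeField (GaugeInvariant gaugeAct)
open Literature.MathematicalPhysics.QuantumFieldTheory.Balaban1983to89.BlockAveraging (avgFun loopHol Idx)
open Literature.MathematicalPhysics.QuantumFieldTheory.Balaban1983to89.ExpMeanLog (expMeanLogSU)
open Literature.MathematicalPhysics.QuantumFieldTheory.Balaban1983to89.T3ContinuumYM3Torus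
open Literature.MathematicalPhysics.QuantumFieldTheory.Balaban1983to89.T3UnitScaleTilt (θBal)
open Literature.MathematicalPhysics.QuantumFieldTheory.Balaban1985CMP102 Literature.MathematicalPhysics.QuantumFieldTheory.Balaban1985CMP102.Setting
open Summit.QuantumFields.Balaban3D.Carriers
open Summit.QuantumFields.Balaban3D.Proofs.Primitives
open Summit.QuantumFields.Balaban3D.Proofs.Thresholds (Q0 Q0_pos)
open Summit.QuantumFields.Balaban3D.Proofs.TowerAC Summit.QuantumFields.Balaban3D.Proofs.StandardAC Summit.QuantumFields.Balaban3D.Proofs.InputsAC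
open Summit.QuantumFields.Balaban3D.Proofs.Bound55Masses (chiB)
open Summit.QuantumFields.Balaban3D.Proofs.GaussianNormalization (partZ normalized)
open Summit.QuantumFields.YangMills.Theorems.PinnedStep (Fibre57LowOnAC)
open scoped NNReal ENNReal

variable {F : T3Family} {𝔠 : AlphaConsts F.L (suGroupModel 2).N} {γ : ℝ} {hγ : 0 < γ} {hγ1 : γ ≤ (min 𝔠.gamma0 1) ^ 2} {K : ℕ}

namespace AlphaInputsT3AC.PkgCoreRows

variable (q : AlphaInputsT3AC.PkgCoreRows F 𝔠 γ hγ hγ1 K)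

/-- ★★★ **THE LOWER ROW `Fibre57LowOnAC` AT THE T³ RECORD ON THE FAMILY `{(4)-window} ∩ chiMinAC (max B₃ 1)`, FROM THE ROWS RECORD** — ✓`fibre57LowOnAC_T3_of_le_gamma_of_hcharge`
with `X := q.X`, `𝔖 := q.𝔖`, `lo := fun j => {(4)-window j} ∩ chiMinAC 𝔠.lane q.X (max 𝔠.B₃ 1) j`, and the record's letters discharged by name: `hav` (✓`avg_XT3_eq_avgFun`),
`hU`∕`hPm`∕`hPb` (`(q.runRows.steps k hk).…` at `Hist.triv`, `cP := q.𝔄.cP k`), `hlom`∕`hloinv`∕`hdom`∕`hlom₁` (✓`hlom_of_rows`∕`hloinv_of_rows`∕`hdom_of_rows`).  What stays displayed: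
chart binders, Gaussian datum, `hinv`, the (55)∕(58) pins of `q.𝔖` at `triv`, `hcharge`. [cite: Balaban1985UV3, (37) p.265 + (47) p.267 + (55)–(58) pp.269–270 + p.272 L32–33;
Balaban1985Variational, Thm 1 (8) p.279] -/
theorem fibre57LowOnAC_T3_maxB₃_of_hcharge (ha₁ : ∀ i, θBal F.L γ 𝔠.b₀ 𝔠.p₀ i ≤ q.a₁)
    (hγs : γ ≤ ((((4500 : ℝ) * (F.L : ℝ) ^ 5)⁻¹ / (𝔠.b₀ * Q0 𝔠.p₀)) ^ 2) ^ 2)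
    (k : ℕ) (hk : k + 1 ≤ K)
    (Φ : GaugeField (F.P K) (k + 1) (Matrix.specialUnitaryGroup (Fin 2) ℂ) × GaugeField (F.P K) k (Matrix.specialUnitaryGroup (Fin 2) ℂ) →
      GaugeField (F.P K) k (Matrix.specialUnitaryGroup (Fin 2) ℂ))
    (J : GaugeField (F.P K) (k + 1) (Matrix.specialUnitaryGroup (Fin 2) ℂ) × GaugeField (F.P K) k (Matrix.specialUnitaryGroup (Fin 2) ℂ) → ℝ≥0)
    (T : Set (GaugeField (F.P K) (k + 1) (Matrix.specialUnitaryGroup (Fin 2) ℂ) × GaugeField (F.P K) k (Matrix.specialUnitaryGroup (Fin 2) ℂ)))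
    (hΦ : Measurable Φ) (hJ : Measurable J) (hT : MeasurableSet T)
    (hmap : ((((fieldMeasure (F.P K) (k + 1) (Matrix.specialUnitaryGroup (Fin 2) ℂ)).prod
        (fieldMeasure (F.P K) k (Matrix.specialUnitaryGroup (Fin 2) ℂ))).restrict T).withDensity (fun z => (J z : ℝ≥0∞))).map Φ =
      (fieldMeasure (F.P K) k (Matrix.specialUnitaryGroup (Fin 2) ℂ)).restrict
        {U : GaugeField (F.P K) k (Matrix.specialUnitaryGroup (Fin 2) ℂ) |
          ∀ c i, dist1 (loopHol U c i) < ((Fintype.card (Idx (F.P K)) : ℝ))⁻¹ / 10})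
    (hfib : ∀ z ∈ T, avgFun (expMeanLogSU (n := Fin 2)) (Φ z) = z.1) (N lσ dg : ℝ)
    (q_1 : GaugeField (F.P K) (k + 1) (Matrix.specialUnitaryGroup (Fin 2) ℂ) → GaugeField (F.P K) k (Matrix.specialUnitaryGroup (Fin 2) ℂ) → ℝ)
    (hqm : ∀ V, Measurable (q_1 V)) (hZ : ∀ V, 0 < partZ (fieldMeasure (F.P K) k (Matrix.specialUnitaryGroup (Fin 2) ℂ)) (q_1 V))
    (hinv : GaugeInvariant (fun U : GaugeField (F.P K) k (Matrix.specialUnitaryGroup (Fin 2) ℂ) =>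
      Real.exp (-((towerOfAC 𝔠.lane q.X q.𝔖).mainT k (Hist.triv (F.P K) k) U) + (towerOfAC 𝔠.lane q.X q.𝔖).Pint k (Hist.triv (F.P K) k) U)))
    (hσ : (piecesAC 𝔠.lane q.X q.𝔖 k).logσ₀ = lσ) (hdg : (piecesAC 𝔠.lane q.X q.𝔖 k).dg = dg)
    (hstar : (piecesAC 𝔠.lane q.X q.𝔖 k).starB (Hist.triv (F.P K) (k + 1)) = N)
    (hZU : ∀ V, (piecesAC 𝔠.lane q.X q.𝔖 k).logZU (Hist.triv (F.P K) (k + 1)) V =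
      Real.log (partZ (fieldMeasure (F.P K) k (Matrix.specialUnitaryGroup (Fin 2) ℂ)) (q_1 V)))
    (hFl : ∀ V, (piecesAC 𝔠.lane q.X q.𝔖 k).logFl (Hist.triv (F.P K) (k + 1)) V =
      Real.log (∫ U', (Real.exp (-((lσ + dg * Real.log ((T3Scales F γ hγ (hγ1.trans (sq_min_one_le _ 𝔠.gamma0_pos)) K).gk k)) * N)) * T.indicator (fun z => (J z : ℝ)) (V, U')) *
              chiB 𝔠.lane.carrier.M₁ (rcolOf (T3Scales F γ hγ (hγ1.trans (sq_min_one_le _ 𝔠.gamma0_pos)) K) 𝔠.lane.carrier) (eps1Of (T3Scales F γ hγ (hγ1.trans (sq_min_one_le _ 𝔠.gamma0_pos)) K) 𝔠.lane.carrier) k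
                (Hist.triv (F.P K) (k + 1)) (Φ (V, U')) *
              Real.exp (-((towerOfAC 𝔠.lane q.X q.𝔖).mainT k (Hist.triv (F.P K) k) (Φ (V, U')) -
                    (towerOfAC 𝔠.lane q.X q.𝔖).mainT (k + 1) (Hist.triv (F.P K) (k + 1)) V)
                + ((towerOfAC 𝔠.lane q.X q.𝔖).Pint k (Hist.triv (F.P K) k) (Φ (V, U')) - (piecesAC 𝔠.lane q.X q.𝔖 k).Pold (Hist.triv (F.P K) (k + 1)) V)
                + q_1 V U')
            ∂(normalized (fieldMeasure (F.P K) k (Matrix.specialUnitaryGroup (Fin 2) ℂ)) (q_1 V))))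
    (hcharge : ∀ Nset : Set (GaugeField (F.P K) (k + 1) (Matrix.specialUnitaryGroup (Fin 2) ℂ)), MeasurableSet Nset →
      Nset ⊆ {V : GaugeField (F.P K) (k + 1) (Matrix.specialUnitaryGroup (Fin 2) ℂ) | PlaqSmall (eps1Of (T3Scales F γ hγ (hγ1.trans (sq_min_one_le _ 𝔠.gamma0_pos)) K) 𝔠.lane.carrier (k + 1)) V} ∩
        PinnedStep.chiMinAC 𝔠.lane q.X (max 𝔠.B₃ 1) (k + 1) →
      fieldMeasure (F.P K) k (Matrix.specialUnitaryGroup (Fin 2) ℂ)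
        ({U : GaugeField (F.P K) k (Matrix.specialUnitaryGroup (Fin 2) ℂ) | ∀ c i, dist1 (loopHol U c i) < ((Fintype.card (Idx (F.P K)) : ℝ))⁻¹ / 10} ∩
          {U | chiB 𝔠.lane.carrier.M₁ (rcolOf (T3Scales F γ hγ (hγ1.trans (sq_min_one_le _ 𝔠.gamma0_pos)) K) 𝔠.lane.carrier) (eps1Of (T3Scales F γ hγ (hγ1.trans (sq_min_one_le _ 𝔠.gamma0_pos)) K) 𝔠.lane.carrier) k (Hist.triv (F.P K) (k + 1)) U ≠ 0} ∩
          (avgFun (expMeanLogSU (n := Fin 2))) ⁻¹' Nset) = 0 →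
      fieldMeasure (F.P K) (k + 1) (Matrix.specialUnitaryGroup (Fin 2) ℂ) Nset = 0) :
    Fibre57LowOnAC 𝔠.lane q.X q.𝔖
      (fun j => {V : GaugeField (F.P K) j (Matrix.specialUnitaryGroup (Fin 2) ℂ) |
          PlaqSmall (eps1Of (T3Scales F γ hγ (hγ1.trans (sq_min_one_le _ 𝔠.gamma0_pos)) K) 𝔠.lane.carrier j) V} ∩ PinnedStep.chiMinAC 𝔠.lane q.X (max 𝔠.B₃ 1) j) k := by
  have hkK : k ≤ K := by omega
  have hkm : k + 1 ≤ F.m + K := by omega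
  exact PinnedStepTrivPins.fibre57LowOnAC_T3_of_le_gamma_of_hcharge 𝔠 q.X q.𝔖 hγs
    (fun j => {V : GaugeField (F.P K) j (Matrix.specialUnitaryGroup (Fin 2) ℂ) |
        PlaqSmall (eps1Of (T3Scales F γ hγ (hγ1.trans (sq_min_one_le _ 𝔠.gamma0_pos)) K) 𝔠.lane.carrier j) V} ∩ PinnedStep.chiMinAC 𝔠.lane q.X (max 𝔠.B₃ 1) j) k hkK
    (PinnedStepTrivPins.avg_XT3_eq_avgFun F γ hγ _ K q.reg q.Uk q.UkH q.hU0 q.hUs hkm)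
    Φ J T hΦ hJ hT hmap hfib N lσ dg q_1 hqm hZ
    ((q.runRows.steps k hk).hU _) ((q.runRows.steps k hk).hPm _) (q.𝔄.cP k) ((q.runRows.steps k hk).hPb _)
    hinv (q.hlom_of_rows ha₁ k hkK) (q.hloinv_of_rows ha₁ k hkK) (q.hdom_of_rows ha₁ k hkK)
    hσ hdg hstar hZU hFl (q.hlom_of_rows ha₁ (k + 1) hk) hcharge

end AlphaInputsT3AC.PkgCoreRows

end Summit.QuantumFields.YangMills.Theorems

end
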